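import Literature.AnabelianGeometry.SemiGraphs.CoveringGraphVertexFibres
import Literature.AnabelianGeometry.SemiGraphs.CoveringGraphEdgeFibres
import Literature.AnabelianGeometry.SemiGraphs.TemperedEdgeLikeProofs
import HarnessLib

/-!
# The covering semi-graph `G_S`: the INCIDENCE dictionary — the edge `(e, ω)` carries the trace of an edge-like
# subgroup `L`, presented THROUGH THE BRANCH `b`, inside a verticial `K` whose trace is verticial at the vertex the
# branch `(b, ω)` abuts to

Mochizuki, *Semi-graphs of anabelioids*, Publ. RIMS **42** (2006), §3: Def. 3.5 (i) p. 37 (the covering `G_S → G`: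
a branch `(b, ω)` of the edge `(e, ω)` abuts to the vertex `(v, ω_v)`, `ω_v` the orbit of the glued points of `ω`),
Thm. 3.7 (i), (iii) pp. 40–41 (verticial subgroups `π̂₁(G_v) → π₁^temp(G)`, edge-like subgroups "images of
`π̂₁(G_e)`"), §2 p. 23 ("the image of `Π_b` in `Π_v`, well-defined up to conjugation"). [cite: MochizukiSemiAnbd2006,
Def 3.5(i) p.37]

PROOF-ONLY brick (abc-iut cell, layer L3, seat abc-iut-L3-t2 gen 5, row «Ex310-GRAPH-ACTION», part G; no
definition, no instance, no new named fact).  Setting of `CoveringGraphVertexFibres.lean` / `CoveringGraphEdgeFibres.lean`: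
`G` coherent with the hypotheses of Prop. 3.6, a chart `c`, a connected tempered `S` with a chart `c_S` of `G_S`, an
orbit `ω₀` of the chart image `X_S` (base point `x₀`, stabiliser `U`), `φ : U → π₁^temp(G_S)` compatible with the
explicit equivalences.  For a branch `b` of `e` abutting to `v` and an orbit `ω` of `S_e`:
* `CovObj.exists_isEdgeHom_normalised_through_branch` — from a verticial `χ` of `G` at `v` whose comparison
  isomorphism is NORMALISED at the vertex-orbit `ω_v = glueOrbit ω` the branch `(b, ω)` abuts to, the edge
  homomorphism `χ_e = χ ∘ Ad(g_{b'}) ∘ b_*` (`g_{b'}` the chosen conjugator of the incidence) has a comparison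
  isomorphism normalised at `ω` (the gluing `S_e ≅ b^* S_v` is natural in `S`);
* `CovObj.trace_range_mem_verticialSubgroups_of_normalised` / `…_mem_edgeLikeSubgroups_of_normalised` —
  a verticial / edge homomorphism of `G` normalised at `ω` has the trace `φ(U ∩ range)` of its range verticial /
  edge-like AT `(v, ω)` / `(e, ω)`;
* `CovObj.exists_branch_traces_of_abuts` — **the incidence dictionary**: there are a verticial `χ` of `G` at `v`
  and `g ∈ Π_v` with the trace of `K = χ(Π_v)` verticial at `(v, glueOrbit ω)` AND the trace of
  `L = χ(g)·χ(Π_b)·χ(g)⁻¹ ≤ K` edge-like at `(e, ω)` — `L` is hosted by `K` THROUGH THE BRANCH `b`.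
Nothing here is about curves; no side is taken on [IUTchIII] Cor. 3.12.
-/

noncomputable section

open CategoryTheory Topology

namespace Literature.AnabelianGeometry.SemiGraphs

open Literature.AlgebraicGeometry.Frobenioids (IsConnectedObj)
open Literature.AlgebraicGeometry.Frobenioids.QuasiTemperoid.BTempConnected (hom_ρ ρ_mul_apply)
open ProfiniteSemiGraph

universe u

/-! ### Two bookkeeping isomorphisms, with their values on points -/

namespace BTemp

variable {G₁ : Type u} [Group G₁] [TopologicalSpace G₁] {G₂ : Type u} [Group G₂] [TopologicalSpace G₂]
  {G₃ : Type u} [Group G₃] [TopologicalSpace G₃]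

/-- `B^temp(φ ∘ β) ≅ B^temp(φ) ⋙ B^temp(β)`, the identity on points. [cite: MochizukiSemiAnbd2006, Rmk 3.1.2 pp.33-34] -/
theorem exists_res_comp_iso_apply (β : G₁ →ₜ* G₂) (φ : G₂ →ₜ* G₃) :
    ∃ i : BTemp.res (φ.comp β) ≅ BTemp.res φ ⋙ BTemp.res β,
      ∀ (X : BTemp G₃) (x : X.obj.V), ((i.inv.app X).hom.hom x : X.obj.V) = x := by
  refine ⟨NatIso.ofComponents (fun X =>
    { hom := homOfEquivariant ((BTemp.res (φ.comp β)).obj X) ((BTemp.res φ ⋙ BTemp.res β).obj X)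
        id (fun _ _ => rfl)
      inv := homOfEquivariant ((BTemp.res φ ⋙ BTemp.res β).obj X) ((BTemp.res (φ.comp β)).obj X)
        id (fun _ _ => rfl)
      hom_inv_id := by
        apply ObjectProperty.hom_ext
        apply Action.Hom.ext
        exact ConcreteCategory.hom_ext _ _ fun x => rfl
      inv_hom_id := by
        apply ObjectProperty.hom_ext
        apply Action.Hom.ext
        exact ConcreteCategory.hom_ext _ _ fun x => rfl }) (fun {X Y} f => ?_), fun X x => rfl⟩
  apply ObjectProperty.hom_ext
  apply Action.Hom.ext
  exact ConcreteCategory.hom_ext _ _ fun x => rfl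

end BTemp

namespace ProfiniteSemiGraph

variable {𝒢 : ProfiniteSemiGraph.{u}}

/-- The gluings `S_e ≅ b^* S_v` as a natural isomorphism `restrictE e ≅ restrictV v ⋙ B^temp(b_*)` (morphisms of
`B^cov(G)` are compatible with the gluings), with its value on points. [cite: MochizukiSemiAnbd2006, §3 p.36] -/
theorem exists_restrictE_iso_restrictV_res_apply (b : 𝒢.graph.Branch) (v : 𝒢.graph.Vertex)
    (h : 𝒢.graph.abuts b = some v) :
    ∃ i : restrictE 𝒢 (𝒢.graph.edgeOf b) ≅ restrictV 𝒢 v ⋙ BTemp.res (𝒢.brHom b v h),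
      ∀ (S : CovObj 𝒢) (x : (S.SE (𝒢.graph.edgeOf b)).obj.V),
        ((i.hom.app S).hom.hom x : (S.SV v).obj.V) = (S.glue b v h).hom.hom.hom x :=
  ⟨NatIso.ofComponents (fun S => S.glue b v h) (fun f => f.comm b v h), fun _ _ => rfl⟩

namespace CovObj

variable (S : CovObj 𝒢)

/-! ### An edge homomorphism normalised at `ω`, THROUGH the branch `(b, ω)` -/

/-- **Normalisation through a branch.**  Let `b` be a branch of `e` abutting to `v`, `ω` an orbit of `S_e`,
`ω_v = glueOrbit ω` the vertex-orbit the branch `(b, ω)` abuts to, and `χ : Π_v → Π` with a comparison isomorphism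
`k : S'_v ≅ χ^*(X_{S'})` (natural in `S'`) NORMALISED at `ω_v` (`k(s_{ω_v}) = x₀`).  Then for the chosen
conjugator `g = g_{(b,ω)} ∈ Π_v` of the incidence (`g · φ_b(s_ω) = s_{ω_v}`) the edge homomorphism
`χ_e(a) = χ(g · b_*(a) · g⁻¹)` has a comparison isomorphism normalised at `ω` (`k_e(s_ω) = x₀`).
[cite: MochizukiSemiAnbd2006, Def 3.5(i) p.37] -/
theorem exists_isEdgeHom_normalised_through_branch (c : TemperedPiChart 𝒢) (hS : S.IsTempered)
    (ω₀ : BTemp.Orbits (c.equiv.functor.obj ⟨S, hS⟩)) {b : 𝒢.graph.Branch} {v : 𝒢.graph.Vertex}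
    (hb : 𝒢.graph.abuts b = some v) (ω : BTemp.Orbits (S.SE (𝒢.graph.edgeOf b)))
    (χ : 𝒢.Gv v →ₜ* c.G) (k : ObjectProperty.ι _ ⋙ restrictV 𝒢 v ≅ c.equiv.functor ⋙ BTemp.res χ)
    (hk : (k.hom.app ⟨S, hS⟩).hom.hom (Quot.out (S.glueOrbit b v hb ω)) =
      (Quot.out ω₀ : (c.equiv.functor.obj ⟨S, hS⟩).obj.V)) :
    ∃ (g : 𝒢.Gv v) (χE : 𝒢.Ge (𝒢.graph.edgeOf b) →ₜ* c.G)
      (kE : ObjectProperty.ι _ ⋙ restrictE 𝒢 (𝒢.graph.edgeOf b) ≅ c.equiv.functor ⋙ BTemp.res χE),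
      (∀ a, χE a = χ (g * 𝒢.brHom b v hb a * g⁻¹)) ∧
      (kE.hom.app ⟨S, hS⟩).hom.hom (Quot.out ω) = (Quot.out ω₀ : (c.equiv.functor.obj ⟨S, hS⟩).obj.V) := by
  haveI := c.isTopologicalGroup
  let X : BTemp c.G := c.equiv.functor.obj ⟨S, hS⟩
  let habut := S.coveringAbuts_eq hb ω
  let g : 𝒢.Gv v := S.conjugator habut
  have hg : (S.SV v).obj.ρ g ((S.glue b v hb).hom.hom.hom (Quot.out ω)) = Quot.out (S.glueOrbit b v hb ω) :=
    S.conjugator_spec habut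
  let κ : 𝒢.Gv v →ₜ* 𝒢.Gv v :=
    { toMonoidHom := (MulAut.conj g).toMonoidHom
      continuous_toFun := by
        change Continuous fun x => g * x * g⁻¹
        fun_prop }
  let χ₁ : 𝒢.Ge (𝒢.graph.edgeOf b) →ₜ* c.G := χ.comp (𝒢.brHom b v hb)
  let χE : 𝒢.Ge (𝒢.graph.edgeOf b) →ₜ* c.G := χ.comp (κ.comp (𝒢.brHom b v hb))
  have hχE : ∀ a, χE a = χ (g * 𝒢.brHom b v hb a * g⁻¹) := fun _ => rfl
  have hconj : ∀ a, χ g * χ₁ a * (χ g)⁻¹ = χE a := fun a => by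
    rw [hχE, map_mul, map_mul, map_inv]; rfl
  obtain ⟨iG, hiG⟩ := exists_restrictE_iso_restrictV_res_apply b v hb
  obtain ⟨iC, hiC⟩ := BTemp.exists_res_comp_iso_apply (𝒢.brHom b v hb) χ
  let r : BTemp.res χ₁ ≅ BTemp.res χE := BTemp.resIsoOfConj χ₁ χE (χ g) hconj
  let kE : ObjectProperty.ι _ ⋙ restrictE 𝒢 (𝒢.graph.edgeOf b) ≅ c.equiv.functor ⋙ BTemp.res χE :=
    (Functor.isoWhiskerLeft (ObjectProperty.ι _) iG :
        ObjectProperty.ι _ ⋙ restrictE 𝒢 (𝒢.graph.edgeOf b) ≅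
          ObjectProperty.ι _ ⋙ restrictV 𝒢 v ⋙ BTemp.res (𝒢.brHom b v hb)) ≪≫
      (Functor.associator _ _ _).symm ≪≫
      (Functor.isoWhiskerRight k (BTemp.res (𝒢.brHom b v hb)) :
        (ObjectProperty.ι _ ⋙ restrictV 𝒢 v) ⋙ BTemp.res (𝒢.brHom b v hb) ≅
          (c.equiv.functor ⋙ BTemp.res χ) ⋙ BTemp.res (𝒢.brHom b v hb)) ≪≫
      Functor.associator _ _ _ ≪≫
      Functor.isoWhiskerLeft c.equiv.functor (iC.symm ≪≫ r)
  refine ⟨g, χE, kE, hχE, ?_⟩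
  -- on points: `s_ω ↦ φ_b(s_ω) ↦ k(φ_b(s_ω)) ↦ χ(g) · k(φ_b(s_ω)) = k(g · φ_b(s_ω)) = k(s_{ω_v}) = x₀`
  have step : ((kE.hom.app ⟨S, hS⟩).hom.hom (Quot.out ω) : X.obj.V) =
      X.obj.ρ (χ g) ((iC.inv.app X).hom.hom
        ((k.hom.app ⟨S, hS⟩).hom.hom ((iG.hom.app S).hom.hom (Quot.out ω)))) := by
    simp only [kE, Iso.trans_hom, Iso.symm_hom, NatTrans.comp_app, Functor.isoWhiskerLeft_hom,
      Functor.isoWhiskerRight_hom, Functor.whiskerLeft_app, Functor.whiskerRight_app, Functor.associator_hom_app,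
      Functor.associator_inv_app, ObjectProperty.FullSubcategory.comp_hom,
      Action.comp_hom, types_comp_apply, BTemp.res_map_hom_hom, r]
    rfl
  rw [step, hiC, hiG]
  -- equivariance of `k` at `g`, then the normalisations `g · φ_b(s_ω) = s_{ω_v}` and `k(s_{ω_v}) = x₀`
  have e1 := hom_ρ (k.hom.app ⟨S, hS⟩) g ((S.glue b v hb).hom.hom.hom (Quot.out ω))
  have e2 : ((k.hom.app ⟨S, hS⟩).hom.hom ((S.SV v).obj.ρ g ((S.glue b v hb).hom.hom.hom (Quot.out ω))) :
      X.obj.V) = Quot.out ω₀ := by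
    rw [hg]; exact hk
  exact e1.symm.trans e2

/-! ### Normalised homomorphisms have their traces AT the prescribed orbit -/

/-- **A verticial homomorphism `χ` of `G` at `v` NORMALISED at `ω` has the trace `φ(U ∩ χ(Π_v))` verticial at the
vertex `(v, ω)` of `G_S`.** [cite: MochizukiSemiAnbd2006, Thm 3.7(i) p.40] -/
theorem trace_range_mem_verticialSubgroups_of_normalised (h36 : 𝒢.Prop36Hypotheses) (hcoh : 𝒢.IsCoherent)
    (c : TemperedPiChart 𝒢) (hS : S.IsTempered) (cS : TemperedPiChart S.coveringGraph)
    (ω₀ : BTemp.Orbits (c.equiv.functor.obj ⟨S, hS⟩))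
    (φ : BTemp.stab (c.equiv.functor.obj ⟨S, hS⟩) (Quot.out ω₀) →ₜ* cS.G)
    (hφ : Nonempty (cS.equiv.inverse ⋙ (S.etaleEquiv uniformSplitting_holds h36 hcoh hS).functor ⋙
          (Over.postEquiv (⟨S, hS⟩ : BTempCat 𝒢) c.equiv).functor ⋙
          BTemp.fibreFamily (c.equiv.functor.obj ⟨S, hS⟩) ⋙
          Pi.eval (fun ω => BTemp (BTemp.stab (c.equiv.functor.obj ⟨S, hS⟩) (Quot.out ω))) ω₀ ≅
        BTemp.res φ))
    (v : 𝒢.graph.Vertex) (ω : BTemp.Orbits (S.SV v)) (χ : 𝒢.Gv v →ₜ* c.G)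
    (k : ObjectProperty.ι _ ⋙ restrictV 𝒢 v ≅ c.equiv.functor ⋙ BTemp.res χ)
    (hk : (k.hom.app ⟨S, hS⟩).hom.hom (Quot.out ω) = (Quot.out ω₀ : (c.equiv.functor.obj ⟨S, hS⟩).obj.V)) :
    (χ.toMonoidHom.range.subgroupOf (BTemp.stab (c.equiv.functor.obj ⟨S, hS⟩) (Quot.out ω₀))).map
        φ.toMonoidHom ∈ verticialSubgroups cS (⟨v, ω⟩ : S.coveringGraph.graph.Vertex) := by
  obtain ⟨ψ, hψ, hiff, ⟨i⟩⟩ := S.exists_ptFibre_compat c hS ω₀ v ω χ k hk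
  obtain ⟨iφ⟩ := hφ
  have hvert : IsVerticialHom cS (⟨v, ω⟩ : S.coveringGraph.graph.Vertex) (φ.comp ψ) := by
    let X : BTemp c.G := c.equiv.functor.obj ⟨S, hS⟩
    let et := S.etaleEquiv uniformSplitting_holds h36 hcoh hS
    let R : BTempCat S.coveringGraph ⥤ BTemp (BTemp.stab (S.SV v) (Quot.out ω)) :=
      ObjectProperty.ι _ ⋙ restrictV S.coveringGraph (⟨v, ω⟩ : S.coveringGraph.graph.Vertex)
    let F₁ := Over.post (X := (⟨S, hS⟩ : BTempCat 𝒢)) (ObjectProperty.ι _ ⋙ restrictV 𝒢 v) ⋙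
      BTemp.fibreFamily (S.SV v) ⋙ Pi.eval (fun ω' => BTemp (BTemp.stab (S.SV v) (Quot.out ω'))) ω
    let F₂ := (Over.postEquiv (⟨S, hS⟩ : BTempCat 𝒢) c.equiv).functor ⋙ BTemp.fibreFamily X ⋙
      Pi.eval (fun ω' => BTemp (BTemp.stab X (Quot.out ω'))) ω₀
    let i1 : R ≅ et.functor ⋙ F₁ :=
      (Functor.isoWhiskerRight et.unitIso R : 𝟭 _ ⋙ R ≅ (et.functor ⋙ et.inverse) ⋙ R)
    let i2 : et.functor ⋙ F₁ ≅ et.functor ⋙ F₂ ⋙ BTemp.res ψ := Functor.isoWhiskerLeft et.functor i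
    let i3 : cS.equiv.inverse ⋙ R ≅ (cS.equiv.inverse ⋙ et.functor ⋙ F₂) ⋙ BTemp.res ψ :=
      Functor.isoWhiskerLeft cS.equiv.inverse (i1 ≪≫ i2)
    exact ⟨i3 ≪≫ (Functor.isoWhiskerRight iφ (BTemp.res ψ) :
      (cS.equiv.inverse ⋙ et.functor ⋙ F₂) ⋙ BTemp.res ψ ≅ BTemp.res φ ⋙ BTemp.res ψ)⟩
  refine ⟨φ.comp ψ, hvert, ?_⟩
  have hψr : ψ.toMonoidHom.range =
      χ.toMonoidHom.range.subgroupOf (BTemp.stab (c.equiv.functor.obj ⟨S, hS⟩) (Quot.out ω₀)) := by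
    ext u
    simp only [MonoidHom.mem_range, Subgroup.mem_subgroupOf, ContinuousMonoidHom.coe_toMonoidHom]
    constructor
    · rintro ⟨h, rfl⟩
      exact ⟨(h : 𝒢.Gv v), (hψ h).symm⟩
    · rintro ⟨a, ha⟩
      have ha' : χ a = (u : c.G) := ha
      have hamem : a ∈ BTemp.stab (S.SV v) (Quot.out ω) := (hiff a).mpr (by rw [ha']; exact u.2)
      refine ⟨⟨a, hamem⟩, Subtype.ext ?_⟩
      show ((ψ ⟨a, hamem⟩ : BTemp.stab (c.equiv.functor.obj ⟨S, hS⟩) (Quot.out ω₀)) : c.G) = u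
      rw [hψ]; exact ha'
  change _ = (φ.toMonoidHom.comp ψ.toMonoidHom).range
  rw [MonoidHom.range_comp, hψr]

/-- **An edge homomorphism `χ` of `G` at `e` NORMALISED at `ω` has the trace `φ(U ∩ χ(Π_e))` edge-like at the edge
`(e, ω)` of `G_S`.** [cite: MochizukiSemiAnbd2006, Thm 3.7(iii) p.41] -/
theorem trace_range_mem_edgeLikeSubgroups_of_normalised (h36 : 𝒢.Prop36Hypotheses) (hcoh : 𝒢.IsCoherent)
    (c : TemperedPiChart 𝒢) (hS : S.IsTempered) (cS : TemperedPiChart S.coveringGraph)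
    (ω₀ : BTemp.Orbits (c.equiv.functor.obj ⟨S, hS⟩))
    (φ : BTemp.stab (c.equiv.functor.obj ⟨S, hS⟩) (Quot.out ω₀) →ₜ* cS.G)
    (hφ : Nonempty (cS.equiv.inverse ⋙ (S.etaleEquiv uniformSplitting_holds h36 hcoh hS).functor ⋙
          (Over.postEquiv (⟨S, hS⟩ : BTempCat 𝒢) c.equiv).functor ⋙
          BTemp.fibreFamily (c.equiv.functor.obj ⟨S, hS⟩) ⋙
          Pi.eval (fun ω => BTemp (BTemp.stab (c.equiv.functor.obj ⟨S, hS⟩) (Quot.out ω))) ω₀ ≅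
        BTemp.res φ))
    (e : 𝒢.graph.Edge) (ω : BTemp.Orbits (S.SE e)) (χ : 𝒢.Ge e →ₜ* c.G)
    (k : ObjectProperty.ι _ ⋙ restrictE 𝒢 e ≅ c.equiv.functor ⋙ BTemp.res χ)
    (hk : (k.hom.app ⟨S, hS⟩).hom.hom (Quot.out ω) = (Quot.out ω₀ : (c.equiv.functor.obj ⟨S, hS⟩).obj.V)) :
    (χ.toMonoidHom.range.subgroupOf (BTemp.stab (c.equiv.functor.obj ⟨S, hS⟩) (Quot.out ω₀))).map
        φ.toMonoidHom ∈ edgeLikeSubgroups cS (⟨e, ω⟩ : S.coveringGraph.graph.Edge) := by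
  obtain ⟨ψ, hψ, hiff, ⟨i⟩⟩ := S.exists_ptFibre_compatE c hS ω₀ e ω χ k hk
  obtain ⟨iφ⟩ := hφ
  have hedge : IsEdgeHom cS (⟨e, ω⟩ : S.coveringGraph.graph.Edge) (φ.comp ψ) := by
    let X : BTemp c.G := c.equiv.functor.obj ⟨S, hS⟩
    let et := S.etaleEquiv uniformSplitting_holds h36 hcoh hS
    let R : BTempCat S.coveringGraph ⥤ BTemp (BTemp.stab (S.SE e) (Quot.out ω)) :=
      ObjectProperty.ι _ ⋙ restrictE S.coveringGraph (⟨e, ω⟩ : S.coveringGraph.graph.Edge)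
    let F₁ := Over.post (X := (⟨S, hS⟩ : BTempCat 𝒢)) (ObjectProperty.ι _ ⋙ restrictE 𝒢 e) ⋙
      BTemp.fibreFamily (S.SE e) ⋙ Pi.eval (fun ω' => BTemp (BTemp.stab (S.SE e) (Quot.out ω'))) ω
    let F₂ := (Over.postEquiv (⟨S, hS⟩ : BTempCat 𝒢) c.equiv).functor ⋙ BTemp.fibreFamily X ⋙
      Pi.eval (fun ω' => BTemp (BTemp.stab X (Quot.out ω'))) ω₀
    let i1 : R ≅ et.functor ⋙ F₁ :=
      (Functor.isoWhiskerRight et.unitIso R : 𝟭 _ ⋙ R ≅ (et.functor ⋙ et.inverse) ⋙ R)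
    let i2 : et.functor ⋙ F₁ ≅ et.functor ⋙ F₂ ⋙ BTemp.res ψ := Functor.isoWhiskerLeft et.functor i
    let i3 : cS.equiv.inverse ⋙ R ≅ (cS.equiv.inverse ⋙ et.functor ⋙ F₂) ⋙ BTemp.res ψ :=
      Functor.isoWhiskerLeft cS.equiv.inverse (i1 ≪≫ i2)
    exact ⟨i3 ≪≫ (Functor.isoWhiskerRight iφ (BTemp.res ψ) :
      (cS.equiv.inverse ⋙ et.functor ⋙ F₂) ⋙ BTemp.res ψ ≅ BTemp.res φ ⋙ BTemp.res ψ)⟩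
  refine ⟨φ.comp ψ, hedge, ?_⟩
  have hψr : ψ.toMonoidHom.range =
      χ.toMonoidHom.range.subgroupOf (BTemp.stab (c.equiv.functor.obj ⟨S, hS⟩) (Quot.out ω₀)) := by
    ext u
    simp only [MonoidHom.mem_range, Subgroup.mem_subgroupOf, ContinuousMonoidHom.coe_toMonoidHom]
    constructor
    · rintro ⟨h, rfl⟩
      exact ⟨(h : 𝒢.Ge e), (hψ h).symm⟩
    · rintro ⟨a, ha⟩
      have ha' : χ a = (u : c.G) := ha
      have hamem : a ∈ BTemp.stab (S.SE e) (Quot.out ω) := (hiff a).mpr (by rw [ha']; exact u.2)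
      refine ⟨⟨a, hamem⟩, Subtype.ext ?_⟩
      show ((ψ ⟨a, hamem⟩ : BTemp.stab (c.equiv.functor.obj ⟨S, hS⟩) (Quot.out ω₀)) : c.G) = u
      rw [hψ]; exact ha'
  change _ = (φ.toMonoidHom.comp ψ.toMonoidHom).range
  rw [MonoidHom.range_comp, hψr]

/-! ### The incidence dictionary -/

/-- The range of `a ↦ χ(g · b_*(a) · g⁻¹)` is `χ(g) · χ(Π_b) · χ(g)⁻¹`. [folklore] -/
private theorem range_eq_map_branchSubgroup_conj {c : TemperedPiChart 𝒢} {b : 𝒢.graph.Branch} {v : 𝒢.graph.Vertex}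
    (hb : 𝒢.graph.abuts b = some v) (χ : 𝒢.Gv v →ₜ* c.G) (g : 𝒢.Gv v)
    (χE : 𝒢.Ge (𝒢.graph.edgeOf b) →ₜ* c.G) (hχE : ∀ a, χE a = χ (g * 𝒢.brHom b v hb a * g⁻¹)) :
    χE.toMonoidHom.range =
      ((𝒢.branchSubgroup b v hb).map χ.toMonoidHom).map (MulAut.conj (χ g)).toMonoidHom := by
  ext x
  constructor
  · rintro ⟨a, rfl⟩
    refine ⟨χ (𝒢.brHom b v hb a), ⟨𝒢.brHom b v hb a, ⟨a, rfl⟩, rfl⟩, ?_⟩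
    show χ g * χ (𝒢.brHom b v hb a) * (χ g)⁻¹ = χE a
    rw [hχE, map_mul, map_mul, map_inv]
  · rintro ⟨_, ⟨_, ⟨a, rfl⟩, rfl⟩, rfl⟩
    refine ⟨a, ?_⟩
    show χE a = χ g * χ (𝒢.brHom b v hb a) * (χ g)⁻¹
    rw [hχE, map_mul, map_mul, map_inv]

/-- **The INCIDENCE dictionary of `G_S`.**  For a branch `b` of `e` abutting to `v` and an orbit `ω` of `S_e` —
so that the branch `(b, ω)` of the edge `(e, ω)` of `G_S` abuts to the vertex `(v, glueOrbit ω)` — there are a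
verticial homomorphism `χ` of `G` at `v` and `g ∈ Π_v` such that the trace `φ(U ∩ K)` of `K = χ(Π_v)` is
verticial at `(v, glueOrbit ω)` AND the trace `φ(U ∩ L)` of the edge-like subgroup `L = χ(g)·χ(Π_b)·χ(g)⁻¹` of `e`
— hosted by `K` THROUGH THE BRANCH `b` — is edge-like at `(e, ω)`. [cite: MochizukiSemiAnbd2006, Def 3.5(i) p.37] -/
theorem exists_branch_traces_of_abuts (h36 : 𝒢.Prop36Hypotheses) (hcoh : 𝒢.IsCoherent)
    (c : TemperedPiChart 𝒢) (hS : S.IsTempered) (hSc : IsConnectedObj (⟨S, hS⟩ : BTempCat 𝒢))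
    (cS : TemperedPiChart S.coveringGraph) (ω₀ : BTemp.Orbits (c.equiv.functor.obj ⟨S, hS⟩))
    (φ : BTemp.stab (c.equiv.functor.obj ⟨S, hS⟩) (Quot.out ω₀) →ₜ* cS.G)
    (hφ : Nonempty (cS.equiv.inverse ⋙ (S.etaleEquiv uniformSplitting_holds h36 hcoh hS).functor ⋙
          (Over.postEquiv (⟨S, hS⟩ : BTempCat 𝒢) c.equiv).functor ⋙
          BTemp.fibreFamily (c.equiv.functor.obj ⟨S, hS⟩) ⋙
          Pi.eval (fun ω => BTemp (BTemp.stab (c.equiv.functor.obj ⟨S, hS⟩) (Quot.out ω))) ω₀ ≅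
        BTemp.res φ))
    {b : 𝒢.graph.Branch} {v : 𝒢.graph.Vertex} (hb : 𝒢.graph.abuts b = some v)
    (ω : BTemp.Orbits (S.SE (𝒢.graph.edgeOf b))) :
    ∃ (χ : 𝒢.Gv v →ₜ* c.G) (g : 𝒢.Gv v), IsVerticialHom c v χ ∧
      (χ.toMonoidHom.range.subgroupOf (BTemp.stab (c.equiv.functor.obj ⟨S, hS⟩) (Quot.out ω₀))).map
          φ.toMonoidHom ∈ verticialSubgroups cS (⟨v, S.glueOrbit b v hb ω⟩ : S.coveringGraph.graph.Vertex) ∧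
      ((((𝒢.branchSubgroup b v hb).map χ.toMonoidHom).map (MulAut.conj (χ g)).toMonoidHom).subgroupOf
          (BTemp.stab (c.equiv.functor.obj ⟨S, hS⟩) (Quot.out ω₀))).map φ.toMonoidHom ∈
        edgeLikeSubgroups cS (⟨𝒢.graph.edgeOf b, ω⟩ : S.coveringGraph.graph.Edge) := by
  obtain ⟨χ₀, hχ₀⟩ := exists_isVerticialHom h36.isQuasiCoherent h36.isGaloisCountable c v
  obtain ⟨χ, k, hχv, hk⟩ :=
    S.exists_isVerticialHom_normalised_at c hS hSc ω₀ v (S.glueOrbit b v hb ω) χ₀ hχ₀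
  obtain ⟨g, χE, kE, hχE, hkE⟩ := S.exists_isEdgeHom_normalised_through_branch c hS ω₀ hb ω χ k hk
  refine ⟨χ, g, hχv,
    S.trace_range_mem_verticialSubgroups_of_normalised h36 hcoh c hS cS ω₀ φ hφ v _ χ k hk, ?_⟩
  rw [← range_eq_map_branchSubgroup_conj hb χ g χE hχE]
  exact S.trace_range_mem_edgeLikeSubgroups_of_normalised h36 hcoh c hS cS ω₀ φ hφ _ ω χE kE hkE

/-- In the incidence dictionary, `L ≤ K`: `χ(g)·χ(Π_b)·χ(g)⁻¹ ≤ χ(Π_v)` for `g ∈ Π_v` (§2 p. 23: "the image of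
`Π_b` in `Π_v`, which is well-defined up to conjugation in `Π_v`"). [cite: MochizukiSemiAnbd2006, §2 p.23] -/
theorem map_branchSubgroup_conj_le_range {c : TemperedPiChart 𝒢} {b : 𝒢.graph.Branch} {v : 𝒢.graph.Vertex}
    (hb : 𝒢.graph.abuts b = some v) (χ : 𝒢.Gv v →ₜ* c.G) (g : 𝒢.Gv v) :
    ((𝒢.branchSubgroup b v hb).map χ.toMonoidHom).map (MulAut.conj (χ g)).toMonoidHom ≤
      χ.toMonoidHom.range := by
  rintro _ ⟨_, ⟨a, _, rfl⟩, rfl⟩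
  refine ⟨g * a * g⁻¹, ?_⟩
  show χ (g * a * g⁻¹) = χ g * χ a * (χ g)⁻¹
  rw [map_mul, map_mul, map_inv]

/-- In the incidence dictionary, `K` is verticial at `v` and `L` is edge-like at `e`. [cite: MochizukiSemiAnbd2006, Thm 3.7(iii) p.41] -/
theorem range_mem_and_map_branchSubgroup_conj_mem {c : TemperedPiChart 𝒢} {b : 𝒢.graph.Branch}
    {v : 𝒢.graph.Vertex} (hb : 𝒢.graph.abuts b = some v) (χ : 𝒢.Gv v →ₜ* c.G) (hχ : IsVerticialHom c v χ)
    (g : 𝒢.Gv v) :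
    χ.toMonoidHom.range ∈ verticialSubgroups c v ∧
      ((𝒢.branchSubgroup b v hb).map χ.toMonoidHom).map (MulAut.conj (χ g)).toMonoidHom ∈
        edgeLikeSubgroups c (𝒢.graph.edgeOf b) :=
  ⟨⟨χ, hχ, rfl⟩, conj_mem_edgeLikeSubgroups' c (map_branchSubgroup_mem_edgeLikeSubgroups c b v hb hχ) _⟩

end CovObj

end ProfiniteSemiGraph

end Literature.AnabelianGeometry.SemiGraphs

end
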